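/- Width seat `ym-line-sfw-p2-w5` (prover-ym-line-sfw-p2-w5-g18-0), free hands for planner ym-idea-2's STUB-PLAN-E (LINE-17 on crux
`AllWindowsColdBox.BoxMidWindowsSU22` = stmt-QuantumFields-24003, stub E `stub_tiltMoments`), piece E(3), first half: colour separation and the
Gram form of the Dirichlet covariance. -/
import Summits.QuantumFields.YangMills.Theorems.AllWindowsColdBoxCubicChaosSecondMoment
import Summits.QuantumFields.YangMills.Theorems.WeakCouplingRatesColdBoxDirichletLargeField

/-!
# Colour separation of a tensor-product cubic Gram norm, and `Q_D⁻¹` as a Gram matrix (STUB-PLAN-E, piece E(3), first half)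

Two self-contained algebraic inputs of the variance bound of the cubic part of the tilt (LINE-17, stub E; the cubic tensor on the legs
`κ = Fin D × DirFree H` is the tensor product `B_{abc} = τ_{a₁b₁c₁}·A_{a₂b₂c₂}` of the ALTERNATING colour tensor of `chartCubic` with the edge tensor
`legTensor`, file `AllWindowsColdBoxTiltCubicForm`, and the two-point kernel of the coordinate process of `gaussD` is colour-block-diagonal
`Γ_{ab} = [a₁ = b₁]·C_{a₂b₂}` with `C = Q_D⁻¹`):

* **`sum6_tensor_blockKernel_eq`** (generic finite types `D`, `X`): for `B_{abc} = τ_{a₁b₁c₁}·A_{a₂b₂c₂}` and `Γ_{ab} = [a₁ = b₁]·C_{a₂b₂}`,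
  `Σ_{abca'b'c'} B_{abc}B_{a'b'c'}Γ_{aa'}Γ_{bb'}Γ_{cc'} = (Σ_{αβγ} τ_{αβγ}²) · Σ_{xyzx'y'z'} A_{xyz}A_{x'y'z'}C_{xx'}C_{yy'}C_{zz'}` — the left-hand side is the
  Gram norm of the tree's third-chaos bound `CubicChaos.integral_cubicForm_sq_le` (reindex the six legs by (colour triple, edge triple) on both
  sides; the three colour indicators collapse the second colour triple onto the first);
* **`dirQinv_eq_sum_mulVec`**: the Dirichlet covariance is a GRAM MATRIX over the plaquettes of the enlarged box,
  `(Q_D⁻¹)_{yy'} = Σ_p (Q_D⁻¹λ_p)_y (Q_D⁻¹λ_p)_{y'}` (`Q_D = Σ_p λ_pλ_pᵀ` is `LatticeMaxwell.Qmat`, and `Q_D⁻¹ = Q_D⁻¹Q_DQ_D⁻¹`) — this turns the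
  leg-pair matrix `⟨P_q,(C⊗C)P_{q'}⟩` into an explicit Gram matrix without square roots, as the `K ⪯ I` lemma
  `sum_sum_boxDirProjKernel_mul_gram_le` wants it (sibling file `AllWindowsColdBoxTiltCubicGram`).

Everything proved; no definition; standard axioms.  HONEST LABEL: helper toward the open registered stub E of a critic-passed line on the R2ξ″
RECORD-rung crux 24003; no stub is proved by name, no crux, rung or summit is proved; the Yang–Mills mass gap is NOT proved by this file.
-/

set_option autoImplicit false

noncomputable section

open Finset Matrix
open Literature.Probability.LatticeModels (Site halfOpenBox)
open Literature.MathematicalPhysics.QuantumLattice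
open Literature.MathematicalPhysics.QuantumFieldTheory
open Literature.MathematicalPhysics.QuantumFieldTheory.LatticeMaxwell
open Literature.MathematicalPhysics.QuantumFieldTheory.AxialGauge
open Summit.QuantumFields.YangMills.Theorems.WeakCouplingRates

namespace Summit.QuantumFields.YangMills.Theorems.ColdBoxAllGroups

/-! ## §1 Colour separation: `Σ B B' ΓΓΓ = (Σ τ²) · Σ A A' CCC` for a colour-block-diagonal kernel -/

section Indicators

variable {D Xs : Type*} [DecidableEq D]

/-- Three colour indicators multiply to the indicator of equal colour triples. -/
theorem ite_mul_ite_mul_ite_eq_ite (c c' : D × D × D) (P Q R : ℝ) :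
    (if c.1 = c'.1 then P else 0) * (if c.2.1 = c'.2.1 then Q else 0) * (if c.2.2 = c'.2.2 then R else 0) =
      if c = c' then P * Q * R else 0 := by
  by_cases h : c = c'
  · subst h; simp
  · rw [if_neg h]
    have : c.1 ≠ c'.1 ∨ c.2.1 ≠ c'.2.1 ∨ c.2.2 ≠ c'.2.2 := by
      by_contra hcon
      push Not at hcon
      exact h (Prod.ext hcon.1 (Prod.ext hcon.2.1 hcon.2.2))
    rcases this with h1 | h2 | h3
    · rw [if_neg h1, zero_mul, zero_mul]
    · rw [if_neg h2, mul_zero, zero_mul]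
    · rw [if_neg h3, mul_zero]

variable [Fintype D] [Fintype Xs]

/-- Collapse of a block-diagonal indicator over a product index: `Σ_{s'} [s₁ = s'₁]·g(s,s') = Σ_{x'} g(s,(s₁,x'))`. -/
theorem sum_ite_fst_eq (s : D × Xs) (g : D × Xs → D × Xs → ℝ) :
    (∑ s' : D × Xs, if s.1 = s'.1 then g s s' else 0) = ∑ x' : Xs, g s (s.1, x') := by
  rw [Fintype.sum_prod_type]
  dsimp only
  rw [Finset.sum_comm]
  refine Finset.sum_congr rfl fun x' _ => ?_
  rw [Finset.sum_ite_eq]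
  simp

end Indicators

section ColourSeparation

variable {D X : Type*} [Fintype D] [DecidableEq D] [Fintype X]

/-- **Colour separation for a tensor-product cubic tensor against a colour-block-diagonal kernel.**  For `B_{abc} = τ_{a₁b₁c₁}·A_{a₂b₂c₂}` on legs
`D × X` and `Γ_{ab} = [a₁ = b₁]·C_{a₂b₂}`:
`Σ_{abca'b'c'} B_{abc}B_{a'b'c'}Γ_{aa'}Γ_{bb'}Γ_{cc'} = (Σ_{αβγ} τ_{αβγ}²) · Σ_{xyzx'y'z'} A_{xyz}A_{x'y'z'}C_{xx'}C_{yy'}C_{zz'}`. -/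
theorem sum6_tensor_blockKernel_eq (τ : D → D → D → ℝ) (A : X → X → X → ℝ) (C : X → X → ℝ) (Γ : D × X → D × X → ℝ)
    (hΓ : ∀ a b, Γ a b = if a.1 = b.1 then C a.2 b.2 else 0) :
    (∑ a : D × X, ∑ b : D × X, ∑ c : D × X, ∑ a' : D × X, ∑ b' : D × X, ∑ c' : D × X,
        (τ a.1 b.1 c.1 * A a.2 b.2 c.2) * (τ a'.1 b'.1 c'.1 * A a'.2 b'.2 c'.2) * (Γ a a' * Γ b b' * Γ c c')) =
      (∑ α, ∑ β, ∑ γ, τ α β γ ^ 2) *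
        ∑ x, ∑ y, ∑ z, ∑ x', ∑ y', ∑ z', A x y z * A x' y' z' * (C x x' * C y y' * C z z') := by
  -- the reindexing `((c,ξ),(c',ξ')) ↦ ((c₁,ξ₁),(c₂,ξ₂),(c₃,ξ₃),(c'₁,ξ'₁),(c'₂,ξ'₂),(c'₃,ξ'₃))` of the flattened six-fold leg sum
  set e : ((D × D × D) × (X × X × X)) × ((D × D × D) × (X × X × X)) ≃
      (D × X) × (D × X) × (D × X) × (D × X) × (D × X) × (D × X) :=
    { toFun := fun w => ((w.1.1.1, w.1.2.1), (w.1.1.2.1, w.1.2.2.1), (w.1.1.2.2, w.1.2.2.2),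
        (w.2.1.1, w.2.2.1), (w.2.1.2.1, w.2.2.2.1), (w.2.1.2.2, w.2.2.2.2))
      invFun := fun z => (((z.1.1, z.2.1.1, z.2.2.1.1), (z.1.2, z.2.1.2, z.2.2.1.2)),
        ((z.2.2.2.1.1, z.2.2.2.2.1.1, z.2.2.2.2.2.1), (z.2.2.2.1.2, z.2.2.2.2.1.2, z.2.2.2.2.2.2)))
      left_inv := fun w => rfl
      right_inv := fun z => rfl } with he
  rw [AllWindowsColdBox.CubicChaos.sum6_eq_sum_prod, ← e.sum_comp, Fintype.sum_prod_type]
  -- the summand in the new variables: `[c = c'] · τ_c A_ξ τ_{c'} A_{ξ'} · CCC`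
  refine Eq.trans (b := ∑ s : (D × D × D) × (X × X × X), ∑ s' : (D × D × D) × (X × X × X),
      if s.1 = s'.1 then (τ s.1.1 s.1.2.1 s.1.2.2 * A s.2.1 s.2.2.1 s.2.2.2) * (τ s'.1.1 s'.1.2.1 s'.1.2.2 * A s'.2.1 s'.2.2.1 s'.2.2.2) *
        (C s.2.1 s'.2.1 * C s.2.2.1 s'.2.2.1 * C s.2.2.2 s'.2.2.2) else 0) ?_ ?_
  · refine Finset.sum_congr rfl fun s _ => Finset.sum_congr rfl fun s' _ => ?_
    simp only [he, Equiv.coe_fn_mk, hΓ]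
    rw [ite_mul_ite_mul_ite_eq_ite]
    split_ifs <;> ring
  -- collapse the colour triple of the second factor onto the first
  refine Eq.trans (Finset.sum_congr rfl fun s _ => sum_ite_fst_eq s (fun s s' =>
      (τ s.1.1 s.1.2.1 s.1.2.2 * A s.2.1 s.2.2.1 s.2.2.2) * (τ s'.1.1 s'.1.2.1 s'.1.2.2 * A s'.2.1 s'.2.2.1 s'.2.2.2) *
        (C s.2.1 s'.2.1 * C s.2.2.1 s'.2.2.1 * C s.2.2.2 s'.2.2.2))) ?_
  rw [Fintype.sum_prod_type]
  dsimp only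
  have hS : ∀ c : D × D × D, (∑ ξ : X × X × X, ∑ ξ' : X × X × X,
      (τ c.1 c.2.1 c.2.2 * A ξ.1 ξ.2.1 ξ.2.2) * (τ c.1 c.2.1 c.2.2 * A ξ'.1 ξ'.2.1 ξ'.2.2) *
        (C ξ.1 ξ'.1 * C ξ.2.1 ξ'.2.1 * C ξ.2.2 ξ'.2.2)) =
      τ c.1 c.2.1 c.2.2 ^ 2 * ∑ x, ∑ y, ∑ z, ∑ x', ∑ y', ∑ z', A x y z * A x' y' z' * (C x x' * C y y' * C z z') := by
    intro c
    rw [show (∑ x, ∑ y, ∑ z, ∑ x', ∑ y', ∑ z', A x y z * A x' y' z' * (C x x' * C y y' * C z z')) =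
        ∑ ξ : X × X × X, ∑ ξ' : X × X × X,
          A ξ.1 ξ.2.1 ξ.2.2 * A ξ'.1 ξ'.2.1 ξ'.2.2 * (C ξ.1 ξ'.1 * C ξ.2.1 ξ'.2.1 * C ξ.2.2 ξ'.2.2) by
      simp only [Fintype.sum_prod_type], Finset.mul_sum]
    refine Finset.sum_congr rfl fun ξ _ => ?_
    rw [Finset.mul_sum]
    refine Finset.sum_congr rfl fun ξ' _ => ?_
    ring
  simp only [hS]
  rw [← Finset.sum_mul]
  simp only [Fintype.sum_prod_type]

end ColourSeparation

/-! ## §2 The Gram form of the Dirichlet covariance `Q_D⁻¹ = Σ_p (Q_D⁻¹λ_p)(Q_D⁻¹λ_p)ᵀ` -/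

section Gram

variable {H : ℕ}

/-- **The Dirichlet covariance is a Gram matrix over the box plaquettes**: since `Q_D = Σ_{p} λ_pλ_pᵀ` (sum over the plaquettes of the
enlarged box) and `Q_D⁻¹ = Q_D⁻¹ Q_D Q_D⁻¹`, `(Q_D⁻¹)_{yy'} = Σ_p (Q_D⁻¹λ_p)_y (Q_D⁻¹λ_p)_{y'}`. -/
theorem dirQinv_eq_sum_mulVec (y y' : DirFree H) :
    (Qmat (fun e => e ∉ dirFreeEdges H) dirCorner (2 * H + 3))⁻¹ y y' =
      ∑ p ∈ plaquettesIn (halfOpenBox 4 (2 * H + 3)),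
        ((Qmat (fun e => e ∉ dirFreeEdges H) dirCorner (2 * H + 3))⁻¹ *ᵥ
            coeff (fun e => e ∉ dirFreeEdges H) dirCorner (2 * H + 3) (Plaq.shift dirCorner p)) y *
          ((Qmat (fun e => e ∉ dirFreeEdges H) dirCorner (2 * H + 3))⁻¹ *ᵥ
            coeff (fun e => e ∉ dirFreeEdges H) dirCorner (2 * H + 3) (Plaq.shift dirCorner p)) y' := by
  set Q := Qmat (fun e => e ∉ dirFreeEdges H) dirCorner (2 * H + 3) with hQ
  have hunit : IsUnit Q.det := (Q.isUnit_iff_isUnit_det).1 (posDef_dirQmat H).isUnit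
  have hsym : Q⁻¹ᵀ = Q⁻¹ := by rw [Matrix.transpose_nonsing_inv, hQ, Qmat_transpose]
  have hQQ : Q⁻¹ = Q⁻¹ * Q * Q⁻¹ := by rw [Matrix.nonsing_inv_mul _ hunit, Matrix.one_mul]
  have hsymm' : ∀ a b, Q⁻¹ a b = Q⁻¹ b a := fun a b =>
    calc Q⁻¹ a b = Q⁻¹ᵀ b a := (Matrix.transpose_apply _ _ _).symm
      _ = Q⁻¹ b a := by rw [hsym]
  have hentry : (Q⁻¹ * Q * Q⁻¹) y y' = ∑ k, ∑ j, Q⁻¹ y j * Q j k * Q⁻¹ y' k := by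
    rw [Matrix.mul_apply]
    refine Finset.sum_congr rfl fun k _ => ?_
    rw [Matrix.mul_apply, Finset.sum_mul]
    refine Finset.sum_congr rfl fun j _ => ?_
    rw [hsymm' k y']
  have hQjk : ∀ j k, Q j k = ∑ p ∈ plaquettesIn (halfOpenBox 4 (2 * H + 3)),
      coeff (fun e => e ∉ dirFreeEdges H) dirCorner (2 * H + 3) (Plaq.shift dirCorner p) j *
        coeff (fun e => e ∉ dirFreeEdges H) dirCorner (2 * H + 3) (Plaq.shift dirCorner p) k := fun j k => by
    rw [hQ, Qmat, Matrix.sum_apply]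
    exact Finset.sum_congr rfl fun p _ => Matrix.vecMulVec_apply _ _ _ _
  conv_lhs => rw [hQQ]
  rw [hentry]
  simp only [hQjk, Finset.mul_sum, Finset.sum_mul]
  rw [Finset.sum_comm]
  refine (Finset.sum_congr rfl fun j _ => Finset.sum_comm).trans ?_
  rw [Finset.sum_comm]
  refine Finset.sum_congr rfl fun p _ => ?_
  simp only [Matrix.mulVec, dotProduct, Finset.sum_mul_sum]
  exact Finset.sum_congr rfl fun j _ => Finset.sum_congr rfl fun k _ => by ring

end Gram

end Summit.QuantumFields.YangMills.Theorems.ColdBoxAllGroups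

end
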